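import Mathlib
import Summits.Ventures.HodgeRepro.Tier4.Line4.FinitePlacePositivity
import Summits.Ventures.HodgeRepro.Tier4.Line4.ProperDefs
import Summits.Ventures.HodgeRepro.Tier4.Line4.SuppMeasure
import Summits.Ventures.HodgeRepro.Tier4.Line4.RatioReduce
import Summits.Ventures.HodgeRepro.Tier4.Line4.CentreFinDomain
import Summits.Ventures.HodgeRepro.Tier4.Line4.CentreCocompact
import Summits.Ventures.HodgeRepro.Tier4.Line4.OrbitalUnfoldCentralCosets

/-!
# Tier4/Line4/SuppMeasureTranslate — (F) pieces (iv) and (v): the translation identity of the unfolded support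
measure and the soft unit `V(N) ≤ suppMeasure N γ₀`

Blind re-derivation cell `pub-hodge-repro`, Tier 4 «prove the step» (README §9–§10), seat t4-L2-p3 (gen 5; plan-4 g5's
ruling S15514 after the finding F-L4-PROJ-NONUNIFORM S15509: the (S-RATIO) display of record is the FOLDED ratio (F);
statements S15538).  Tree path `lean/Summits/Ventures/HodgeRepro/Tier4/Line4/SuppMeasureTranslate.lean`.  Imports
L2-p1's `SuppMeasure` (`suppSet`, `suppMeasure`), `RatioReduce` (`fibreSet`, `suppMeasure_eq_lintegral_fibre`),
`ProperDefs` (`diagCentreFin`, `orbit_mul_diagCentreFin`), L2-p2's `CentreFinDomain` (`centreFin`, `centreFin_comm`),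
typer-2's `CentreCocompact` (`ofFinPart_mem_centre`) and this seat's `FinitePlacePositivity` (`ofFinPart_mul/inv`).

* `fibreSet_conj`: `fibreSet (b₀⁻¹ γ b₀′) b = (b₀′ * ·) ⁻¹' fibreSet γ (b₀ b)` — the support set at `b₀⁻¹ γ b₀′` is
  the translate of the one at `γ` (algebra: `suppSet γ = (b₀, b₀′) • suppSet (b₀⁻¹ γ b₀′)`);
* `fibreSet_centreFin_mul`: the fibre at `z b`, `z ∈ Z(k)`, is a `T′_f`-translate of the fibre at `b`;
* **`suppMeasure_conj_eq`** (iv): `suppMeasure N γ = suppMeasure N (b₀⁻¹ γ b₀′)` for EVERY `b₀ ∈ T_f`, `b₀′ ∈ T′_f` —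
  Haar invariance of `ν′_f` on the fibres, the translate `b₀ DZ_f` is again a `Z(k)`-fundamental domain
  (`IsFundamentalDomain.image_of_equiv`, `Z(k)` central), and the fibre function is `Z(k)`-invariant
  (`IsFundamentalDomain.setLIntegral_eq`);
* `exists_mem_levelDoubleCoset_suppMeasure_eq` (iv′): a point with a non-empty support set has the support measure of
  a point of the double coset `K(N) γ₀,f K(N)` itself — the uniformity in `γ` of any ratio statement is reduced to
  the double coset;
* **`measure_levelBox_mul_diagCentreFin_le_suppMeasure`** (v): the `Δ(Z_f)`-saturated level box lies in
  `suppSet γ₀ N γ₀`, so its `DZ_f`-cut measure `V(N)` is `≤ suppMeasure N γ₀` — the soft unit of (F).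

No printed input is consumed.  HC_CM is NOT proved by anyone in this repository.
-/

set_option autoImplicit false
noncomputable section
namespace Summit.Ventures.HodgeRepro.Tier4.Line4
open Summit.Ventures.HodgeRepro.Tier4 Summit.Ventures.HodgeRepro.Tier4.Common
  Summit.Ventures.HodgeRepro.Tier4.Line1 MeasureTheory
open scoped ENNReal Pointwise

section Algebra
variable {k : Type} [Field k] [NumberField k] (W : PlaneData k) (γ₀ : GA W) (N : ℕ)

/-- The elements of `T′_f` are in the finite part of `G(𝔸_k)`. -/
theorem coe_coe_mem_finitePart' (x : torusFin' W) : ((x : torusT' W) : GA W) ∈ finitePart W :=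
  Subgroup.mem_subgroupOf.1 x.2

/-- The finite part of `b₀⁻¹ γ b₀′` (`b₀ ∈ T_f`, `b₀′ ∈ T′_f`) is `b₀⁻¹ γ_f b₀′`. -/
theorem ofFinPart_conj (γ : GA W) (b₀ : torusFin W) (b₀' : torusFin' W) :
    GA.ofFinPart W ((((b₀ : torusT W) : GA W))⁻¹ * γ * ((b₀' : torusT' W) : GA W)) =
      (((b₀ : torusT W) : GA W))⁻¹ * GA.ofFinPart W γ * ((b₀' : torusT' W) : GA W) := by
  rw [ofFinPart_mul, ofFinPart_mul, ofFinPart_inv, ofFinPart_eq_self_of_mem_finitePart W (coe_coe_mem_finitePart W b₀),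
    ofFinPart_eq_self_of_mem_finitePart W (coe_coe_mem_finitePart' W b₀')]

/-- **The fibre at `b₀⁻¹ γ b₀′` is a translate of the fibre at `γ`**:
`fibreSet (b₀⁻¹ γ b₀′) b = (b₀′ * ·) ⁻¹' fibreSet γ (b₀ b)`. -/
theorem fibreSet_conj (γ : GA W) (b₀ : torusFin W) (b₀' : torusFin' W) (b : torusFin W) :
    fibreSet W γ₀ N ((((b₀ : torusT W) : GA W))⁻¹ * γ * ((b₀' : torusT' W) : GA W)) b =
      (fun c' : torusFin' W => b₀' * c') ⁻¹' fibreSet W γ₀ N γ (b₀ * b) := by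
  ext c'
  simp only [fibreSet, Set.mem_setOf_eq, Set.mem_preimage, ofFinPart_conj]
  have h : (((b : torusT W) : GA W))⁻¹ * ((((b₀ : torusT W) : GA W))⁻¹ * GA.ofFinPart W γ *
        ((b₀' : torusT' W) : GA W)) * ((c' : torusT' W) : GA W) =
      (((b₀ * b : torusFin W) : torusT W) : GA W)⁻¹ * GA.ofFinPart W γ * (((b₀' * c' : torusFin' W) : torusT' W) : GA W) := by
    simp only [Subgroup.coe_mul, mul_inv_rev, mul_assoc]
  rw [h]

/-- **The fibre at `z b` for `z ∈ Z(k)` is a `T′_f`-translate of the fibre at `b`** (the central element passes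
through `γ_f`): for `z = finTfHom z₀`, `z₀ ∈ Z(k) ≤ T(𝔸)`, with `ζ ∈ T′_f` the same element of `G(𝔸)`. -/
theorem fibreSet_centreFin_mul (γ : GA W) {z : torusFin W} (hz : z ∈ centreFin W) (b : torusFin W) :
    ∃ ζ : torusFin' W, ((ζ : torusT' W) : GA W) = ((z : torusT W) : GA W) ∧
      fibreSet W γ₀ N γ (z * b) = (fun c' : torusFin' W => ζ⁻¹ * c') ⁻¹' fibreSet W γ₀ N γ b := by
  obtain ⟨z₀, hz₀, rfl⟩ := hz
  have hzc : ((finTfHom W z₀ : torusT W) : GA W) ∈ centre W := by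
    rw [coe_coe_finTfHom]
    exact ofFinPart_mem_centre W (rationalCentreT.mem_centre W hz₀)
  have hzf : ((finTfHom W z₀ : torusT W) : GA W) ∈ finitePart W := coe_coe_mem_finitePart W _
  refine ⟨⟨⟨((finTfHom W z₀ : torusT W) : GA W), centre_le_torusT' W hzc⟩, Subgroup.mem_subgroupOf.2 hzf⟩, rfl, ?_⟩
  ext c'
  simp only [fibreSet, Set.mem_setOf_eq, Set.mem_preimage]
  have hC : ∀ g : GA W, Commute g ((finTfHom W z₀ : torusT W) : GA W) :=
    fun g => Subgroup.mem_center_iff.1 (centre_le_center W hzc) g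
  have hcoe : ((((⟨⟨((finTfHom W z₀ : torusT W) : GA W), centre_le_torusT' W hzc⟩,
      Subgroup.mem_subgroupOf.2 hzf⟩ : torusFin' W)⁻¹ * c' : torusFin' W) : torusT' W) : GA W) =
      (((finTfHom W z₀ : torusT W) : GA W))⁻¹ * ((c' : torusT' W) : GA W) := rfl
  have h : ((((finTfHom W z₀) * b : torusFin W) : torusT W) : GA W)⁻¹ * GA.ofFinPart W γ * ((c' : torusT' W) : GA W) =
      (((b : torusT W) : GA W))⁻¹ * GA.ofFinPart W γ *
        ((((finTfHom W z₀ : torusT W) : GA W))⁻¹ * ((c' : torusT' W) : GA W)) := by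
    calc ((((finTfHom W z₀) * b : torusFin W) : torusT W) : GA W)⁻¹ * GA.ofFinPart W γ * ((c' : torusT' W) : GA W)
        = (((b : torusT W) : GA W))⁻¹ * ((((finTfHom W z₀ : torusT W) : GA W))⁻¹ * GA.ofFinPart W γ) *
            ((c' : torusT' W) : GA W) := by
          simp only [Subgroup.coe_mul, mul_inv_rev, mul_assoc]
      _ = (((b : torusT W) : GA W))⁻¹ * (GA.ofFinPart W γ * (((finTfHom W z₀ : torusT W) : GA W))⁻¹) *
            ((c' : torusT' W) : GA W) := by
          rw [((hC (GA.ofFinPart W γ)).inv_right).eq]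
      _ = _ := by simp only [mul_assoc]
  rw [hcoe, h]

end Algebra

section Countable
variable {k : Type} [Field k] [NumberField k] (W : PlaneData k)

/-- `Z(k)`'s image in `T_f` is countable (the image of the countable `Z(k)`). -/
theorem countable_centreFin : Countable (centreFin W) := by
  haveI := countable_rationalCentreT W
  have h : (centreFin W : Set (torusFin W)).Countable := by
    rw [centreFin, Subgroup.coe_map]
    exact (Set.to_countable (rationalCentreT W : Set (torusT W))).image _
  exact h.to_subtype

end Countable

section Measure
variable {k : Type} [Field k] [NumberField k] (W : PlaneData k) [MeasurableSpace (GA W)] [BorelSpace (GA W)]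
  (νf : Measure (torusFin W)) (νf' : Measure (torusFin' W)) (γ₀ : GA W) (DZf : Set (torusFin W))

/-- The fibre function `b ↦ ν′_f(fibreSet γ b)` is `Z(k)`-invariant. -/
theorem measure_fibreSet_centreFin_smul [νf'.IsHaarMeasure] (N : ℕ) (γ : GA W) (z : centreFin W) (b : torusFin W) :
    νf' (fibreSet W γ₀ N γ (z • b)) = νf' (fibreSet W γ₀ N γ b) := by
  haveI : BorelSpace (torusT' W) := Subtype.borelSpace _
  haveI : BorelSpace (torusFin' W) := Subtype.borelSpace _
  obtain ⟨ζ, -, hζ⟩ := fibreSet_centreFin_mul W γ₀ N γ z.2 b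
  change νf' (fibreSet W γ₀ N γ ((z : torusFin W) * b)) = _
  rw [hζ]
  exact measure_preimage_mul νf' ζ⁻¹ _

/-- The translate of the fibre function: `ν′_f(fibreSet (b₀⁻¹ γ b₀′) b) = ν′_f(fibreSet γ (b₀ b))`. -/
theorem measure_fibreSet_conj [νf'.IsHaarMeasure] (N : ℕ) (γ : GA W) (b₀ : torusFin W) (b₀' : torusFin' W)
    (b : torusFin W) :
    νf' (fibreSet W γ₀ N ((((b₀ : torusT W) : GA W))⁻¹ * γ * ((b₀' : torusT' W) : GA W)) b) =
      νf' (fibreSet W γ₀ N γ (b₀ * b)) := by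
  haveI : BorelSpace (torusT' W) := Subtype.borelSpace _
  haveI : BorelSpace (torusFin' W) := Subtype.borelSpace _
  rw [fibreSet_conj]
  exact measure_preimage_mul νf' b₀' _

/-- A left translate of a `Z(k)`-fundamental domain of `T_f` is a `Z(k)`-fundamental domain (`Z(k)` is central). -/
theorem isFundamentalDomain_mul_left [νf.IsHaarMeasure] (hfd : IsFundamentalDomain (centreFin W) DZf νf)
    (b₀ : torusFin W) : IsFundamentalDomain (centreFin W) ((fun b : torusFin W => b₀ * b) '' DZf) νf := by
  haveI : BorelSpace (torusT W) := Subtype.borelSpace _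
  haveI : BorelSpace (torusFin W) := Subtype.borelSpace _
  refine hfd.image_of_equiv (Equiv.mulLeft b₀) ?_ (Equiv.refl _) ?_
  · exact (measurePreserving_mul_left νf b₀⁻¹).quasiMeasurePreserving
  · intro z b
    show b₀ * ((z : torusFin W) * b) = (z : torusFin W) * (b₀ * b)
    rw [← mul_assoc, ← centreFin_comm W z.2 b₀, mul_assoc]

/-- **(iv) THE TRANSLATION IDENTITY**: the unfolded support measure at `γ` equals the one at `b₀⁻¹ γ b₀′` for ANY
`b₀ ∈ T_f`, `b₀′ ∈ T′_f`. -/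
theorem suppMeasure_conj_eq [νf.IsHaarMeasure] [νf'.IsHaarMeasure] {N : ℕ} (hN : N ≠ 0)
    (hDZf : MeasurableSet DZf) (hfd : IsFundamentalDomain (centreFin W) DZf νf) (γ : GA W)
    (b₀ : torusFin W) (b₀' : torusFin' W) :
    suppMeasure W νf νf' γ₀ DZf N γ =
      suppMeasure W νf νf' γ₀ DZf N ((((b₀ : torusT W) : GA W))⁻¹ * γ * ((b₀' : torusT' W) : GA W)) := by
  haveI : BorelSpace (torusT W) := Subtype.borelSpace _
  haveI : BorelSpace (torusFin W) := Subtype.borelSpace _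
  haveI : Countable (centreFin W) := countable_centreFin W
  haveI : SMulInvariantMeasure (torusFin W) (torusFin W) νf := ⟨fun c _ _ => measure_preimage_mul νf c _⟩
  haveI : SMulInvariantMeasure (centreFin W) (torusFin W) νf := Subgroup.smulInvariantMeasure _
  haveI : MeasurableConstSMul (torusFin W) (torusFin W) := ⟨fun c => measurable_const_mul c⟩
  haveI : MeasurableConstSMul (centreFin W) (torusFin W) := ⟨fun c => measurable_const_mul (c : torusFin W)⟩
  rw [suppMeasure_eq_lintegral_fibre W νf νf' γ₀ DZf N γ hN hDZf,
    suppMeasure_eq_lintegral_fibre W νf νf' γ₀ DZf N _ hN hDZf]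
  simp_rw [measure_fibreSet_conj W νf' γ₀ N γ b₀ b₀']
  -- change of variables `b ↦ b₀ b` on the right, then the two fundamental domains
  have hemb : MeasurableEmbedding (fun b : torusFin W => b₀ * b) := (MeasurableEquiv.mulLeft b₀).measurableEmbedding
  have hpre : (fun b : torusFin W => b₀ * b) ⁻¹' ((fun b : torusFin W => b₀ * b) '' DZf) = DZf :=
    Set.preimage_image_eq _ (mul_right_injective b₀)
  have hcv := (measurePreserving_mul_left νf b₀).setLIntegral_comp_preimage_emb hemb
    (fun b => νf' (fibreSet W γ₀ N γ b)) ((fun b : torusFin W => b₀ * b) '' DZf)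
  rw [hpre] at hcv
  rw [hcv]
  exact hfd.setLIntegral_eq (isFundamentalDomain_mul_left W νf DZf hfd b₀) (fun b => νf' (fibreSet W γ₀ N γ b))
    (measure_fibreSet_centreFin_smul W νf' γ₀ N γ)

/-- **(iv′)**: a point whose support set meets `DZ_f × T′_f` has the support measure of a point of the double coset
`K(N) γ₀,f K(N)` (in the finite part). -/
theorem exists_mem_levelDoubleCoset_suppMeasure_eq [νf.IsHaarMeasure] [νf'.IsHaarMeasure] {N : ℕ} (hN : N ≠ 0)
    (hDZf : MeasurableSet DZf) (hfd : IsFundamentalDomain (centreFin W) DZf νf) (γ : GA W)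
    (hne : (suppSet W γ₀ N γ ∩ DZf ×ˢ Set.univ).Nonempty) :
    ∃ x ∈ levelDoubleCoset W N (GA.ofFinPart W γ₀), x ∈ finitePart W ∧
      suppMeasure W νf νf' γ₀ DZf N γ = suppMeasure W νf νf' γ₀ DZf N x := by
  obtain ⟨⟨b₀, b₀'⟩, hmem, -⟩ := hne
  refine ⟨(((b₀ : torusT W) : GA W))⁻¹ * GA.ofFinPart W γ * ((b₀' : torusT' W) : GA W), hmem, ?_, ?_⟩
  · exact (finitePart W).mul_mem ((finitePart W).mul_mem ((finitePart W).inv_mem (coe_coe_mem_finitePart W b₀))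
      (ofFinPart_mem_finitePart W γ)) (coe_coe_mem_finitePart' W b₀')
  · rw [suppMeasure_conj_eq W νf νf' γ₀ DZf hN hDZf hfd γ b₀ b₀']
    have hset : suppSet W γ₀ N ((((b₀ : torusT W) : GA W))⁻¹ * γ * ((b₀' : torusT' W) : GA W)) =
        suppSet W γ₀ N ((((b₀ : torusT W) : GA W))⁻¹ * GA.ofFinPart W γ * ((b₀' : torusT' W) : GA W)) := by
      ext p
      simp only [suppSet, Set.mem_setOf_eq, ofFinPart_conj,
        ofFinPart_eq_self_of_mem_finitePart W (ofFinPart_mem_finitePart W γ)]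
    unfold suppMeasure
    rw [hset]

end Measure

section Unit
variable {k : Type} [Field k] [NumberField k] (W : PlaneData k) [MeasurableSpace (GA W)]
  (νf : Measure (torusFin W)) (νf' : Measure (torusFin' W)) (γ₀ : GA W) (DZf : Set (torusFin W))

omit [MeasurableSpace (GA W)] in
/-- **(v) the `Δ(Z_f)`-saturated level box lies in the support set of `γ₀`**. -/
theorem levelBox_mul_diagCentreFin_subset_suppSet (N : ℕ) :
    (levelTf W N ×ˢ levelTf' W N) * diagCentreFin W ⊆ suppSet W γ₀ N γ₀ := by
  rintro p ⟨q, hq, r, hr, rfl⟩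
  show ((((q * r : torusFin W × torusFin' W).1 : torusT W) : GA W))⁻¹ * GA.ofFinPart W γ₀ *
    (((q * r : torusFin W × torusFin' W).2 : torusT' W) : GA W) ∈ levelDoubleCoset W N (GA.ofFinPart W γ₀)
  have h := orbit_mul_diagCentreFin W γ₀ q r hr
  simp only [Prod.fst_mul, Prod.snd_mul]
  rw [h]
  exact levelTf_prod_subset_suppSet W γ₀ N hq

/-- **(v) THE SOFT UNIT**: `V(N) := (ν_f ⊗ ν′_f)((levelTf N × levelTf′ N) · Δ(Z_f) ∩ (DZ_f × T′_f)) ≤ suppMeasure N γ₀`. -/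
theorem measure_levelBox_mul_diagCentreFin_le_suppMeasure (N : ℕ) :
    (νf.prod νf') (((levelTf W N ×ˢ levelTf' W N) * diagCentreFin W) ∩ DZf ×ˢ Set.univ) ≤
      suppMeasure W νf νf' γ₀ DZf N γ₀ :=
  measure_mono (Set.inter_subset_inter_left _ (levelBox_mul_diagCentreFin_subset_suppSet W γ₀ N))

end Unit

end Summit.Ventures.HodgeRepro.Tier4.Line4
end
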